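import Mathlib.Tactic
import Summits.Ventures.PercRepro.C025ProfileThinGirthSigma

/-!
# THE `g`-CASCADE FOR EVERY `g`: THE ARITHMETIC IN CLOSED FORM — part A: THE PRODUCTS AND THE ELEMENTARY BOUNDS (night-3 g16)
The inside-out chain of the `g`-circuit cascade (`C025ProfileThinGirthArith4` … `Arith8` are its instances `g = 4 … 8`) solved in CLOSED
FORM for every `g`: with `s_Q = (g−1)/(g(q+2−g))`, `ε = 1/f − s_Q` and the products
`R s = ∏_{j=s+1}^{g−1} (g+1−j)(q+1−j) / (j (f−g+j))` (`R (g−1) = 1`), the weights are `a_s = 1 + ε R_s` (`1 ≤ s ≤ g−1`), `a_0 = 1`,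
`b_{s−1} = 1 − ((q+1−s)/s) ε R_s` (`1 ≤ s ≤ g−1`). This part: `genR_exists` — the products in the PAIRED form
`∏_{i<g−1−s} (i+2)(q−s−i) / ((i+s+1)(f−1−i))`, so that `0 ≤ R s ≤ 1` (`s ≥ 1`) is termwise, `R s = 1` for `s ≥ g − 1`, and the recurrence
`R (s−1) = (g+1−s)(q+1−s)/(s(f−g+s)) · R s` (by `Finset.prod_range_succ` / `prod_range_succ'` on the four factors); the elementary bounds
`gen_a_bounds` (`0 ≤ 1 + ε R ≤ 2`), `gen_b_bounds` (`0 ≤ 1 − y ε R ≤ 2`), **`gen_key`** (the type-0 demand `G Q ε ≤ 1` for `Q ≥ G(G−2)`,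
`F ≥ Q`: `G Q (G(Q+2−G) − (G−1)F) ≤ F (GQ + 2 − G)` because `(G−1)(G−2) ≥ 0`), the EXACT identities of the demands, the capacities, the
top demand and the `Q'`-capacity, and the (Cap)(iii) bound `gen_capiii` of the uniform inner payment `σ = 2/f` (`3(g−1) ≤ q + 1`).
Part B (`C025ProfileThinGirthArithGen`) assembles them into the hypotheses of `profileIneq_thinGirth_of_weights`. No matroid in this file.
-/
namespace PercRepro
namespace ThinGirth

/-- The products `R s` of the general cascade: `R s = ∏_{i < g−1−s} (i+2)(q−s−i) / ((i+s+1)(f−1−i))`, with `0 ≤ R s ≤ 1` for `s ≥ 1`,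
`R s = 1` for `s ≥ g − 1`, and the recurrence `R (s−1) = (g+1−s)(q+1−s) / (s (f−g+s)) · R s` for `1 ≤ s ≤ g − 1`. -/
theorem genR_exists (g q f : ℕ) (hq : g ≤ q) (hf : q ≤ f) :
    ∃ R : ℕ → ℚ, (∀ s, 1 ≤ s → 0 ≤ R s ∧ R s ≤ 1) ∧ (∀ s, g ≤ s + 1 → R s = 1) ∧
      (∀ s, 1 ≤ s → s + 1 ≤ g →
        R (s - 1) = ((g : ℚ) + 1 - s) * ((q : ℚ) + 1 - s) / ((s : ℚ) * ((f : ℚ) - g + s)) * R s) := by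
  refine ⟨fun s => ((∏ i ∈ Finset.range (g - 1 - s), ((i : ℚ) + 2)) *
      (∏ i ∈ Finset.range (g - 1 - s), ((q : ℚ) - s - i))) /
      ((∏ i ∈ Finset.range (g - 1 - s), ((i : ℚ) + s + 1)) *
      (∏ i ∈ Finset.range (g - 1 - s), ((f : ℚ) - 1 - i))), ?_, ?_, ?_⟩
  · intro s hs
    have hs1 : (1 : ℚ) ≤ s := by exact_mod_cast hs
    have hqf : (q : ℚ) ≤ f := by exact_mod_cast hf
    have hD1 : 0 < ∏ i ∈ Finset.range (g - 1 - s), ((i : ℚ) + s + 1) :=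
      Finset.prod_pos (fun i _ => by positivity)
    have hD2 : 0 < ∏ i ∈ Finset.range (g - 1 - s), ((f : ℚ) - 1 - i) := by
      apply Finset.prod_pos
      intro i hi
      rw [Finset.mem_range] at hi
      have : (i : ℚ) + 2 ≤ f := by exact_mod_cast (by omega : i + 2 ≤ f)
      linarith
    have hN1 : 0 ≤ ∏ i ∈ Finset.range (g - 1 - s), ((i : ℚ) + 2) :=
      Finset.prod_nonneg (fun i _ => by positivity)
    have hN2 : 0 ≤ ∏ i ∈ Finset.range (g - 1 - s), ((q : ℚ) - s - i) := by
      apply Finset.prod_nonneg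
      intro i hi
      rw [Finset.mem_range] at hi
      have : (s : ℚ) + i ≤ q := by exact_mod_cast (by omega : s + i ≤ q)
      linarith
    have h1 : ∏ i ∈ Finset.range (g - 1 - s), ((i : ℚ) + 2) ≤
        ∏ i ∈ Finset.range (g - 1 - s), ((i : ℚ) + s + 1) := by
      apply Finset.prod_le_prod (fun i _ => by positivity)
      intro i _
      linarith
    have h2 : ∏ i ∈ Finset.range (g - 1 - s), ((q : ℚ) - s - i) ≤
        ∏ i ∈ Finset.range (g - 1 - s), ((f : ℚ) - 1 - i) := by
      apply Finset.prod_le_prod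
      · intro i hi
        rw [Finset.mem_range] at hi
        have : (s : ℚ) + i ≤ q := by exact_mod_cast (by omega : s + i ≤ q)
        linarith
      · intro i _
        linarith
    constructor
    · exact div_nonneg (mul_nonneg hN1 hN2) (le_of_lt (mul_pos hD1 hD2))
    · rw [div_le_one (mul_pos hD1 hD2)]
      exact mul_le_mul h1 h2 hN2 (le_of_lt hD1)
  · intro s hs
    have e : g - 1 - s = 0 := by omega
    simp [e]
  · intro s hs1 hsg
    obtain ⟨s', rfl⟩ : ∃ s', s = s' + 1 := ⟨s - 1, by omega⟩
    obtain ⟨k, hk⟩ : ∃ k, g - 1 - (s' + 1) = k := ⟨_, rfl⟩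
    have hk' : g - 1 - s' = k + 1 := by omega
    have hkc : (k : ℚ) = (g : ℚ) - 2 - s' := by
      have h : k + 2 + s' = g := by omega
      have h' := congrArg (fun n : ℕ => (n : ℚ)) h
      push_cast at h'
      linarith
    simp only [Nat.add_sub_cancel, hk, hk']
    rw [Finset.prod_range_succ (fun i => ((i : ℚ) + 2)) k,
      Finset.prod_range_succ' (fun i => ((q : ℚ) - s' - i)) k,
      Finset.prod_range_succ' (fun i => ((i : ℚ) + s' + 1)) k,
      Finset.prod_range_succ (fun i => ((f : ℚ) - 1 - i)) k]
    have e1 : ∏ i ∈ Finset.range k, ((q : ℚ) - s' - ((i + 1 : ℕ) : ℚ)) =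
        ∏ i ∈ Finset.range k, ((q : ℚ) - ((s' + 1 : ℕ) : ℚ) - i) := by
      apply Finset.prod_congr rfl
      intro i _
      push_cast
      ring
    have e2 : ∏ i ∈ Finset.range k, (((i + 1 : ℕ) : ℚ) + s' + 1) =
        ∏ i ∈ Finset.range k, ((i : ℚ) + ((s' + 1 : ℕ) : ℚ) + 1) := by
      apply Finset.prod_congr rfl
      intro i _
      push_cast
      ring
    rw [e1, e2]
    have hD1 : (∏ i ∈ Finset.range k, ((i : ℚ) + ((s' + 1 : ℕ) : ℚ) + 1)) ≠ 0 :=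
      ne_of_gt (Finset.prod_pos (fun i _ => by positivity))
    have hD2 : (∏ i ∈ Finset.range k, ((f : ℚ) - 1 - i)) ≠ 0 := by
      apply ne_of_gt
      apply Finset.prod_pos
      intro i hi
      rw [Finset.mem_range] at hi
      have : (i : ℚ) + 2 ≤ f := by exact_mod_cast (by omega : i + 2 ≤ f)
      linarith
    have hs0 : ((s' + 1 : ℕ) : ℚ) ≠ 0 := by positivity
    have hfg : (f : ℚ) - g + ((s' + 1 : ℕ) : ℚ) ≠ 0 := by
      have : (g : ℚ) ≤ f := by exact_mod_cast (le_trans hq hf)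
      have : (0 : ℚ) < (f : ℚ) - g + ((s' + 1 : ℕ) : ℚ) := by push_cast; linarith
      exact ne_of_gt this
    have hfk : (f : ℚ) - 1 - k ≠ 0 := by
      rw [hkc]
      have : (g : ℚ) ≤ f := by exact_mod_cast (le_trans hq hf)
      have : (0 : ℚ) < (f : ℚ) - 1 - ((g : ℚ) - 2 - s') := by linarith
      exact ne_of_gt this
    rw [div_mul_div_comm]
    push_cast at hD1 hD2 hs0 hfg hfk ⊢
    refine (div_eq_div_iff ?_ ?_).mpr ?_
    · exact mul_ne_zero (mul_ne_zero hD1 (by positivity)) (mul_ne_zero hD2 hfk)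
    · exact mul_ne_zero (mul_ne_zero hs0 hfg) (mul_ne_zero hD1 hD2)
    · rw [hkc]
      ring

/-- `0 ≤ 1 + ε R ≤ 2` for `−1 ≤ ε ≤ 1`, `0 ≤ R ≤ 1` (the `a`-weights). -/
theorem gen_a_bounds {ε R : ℚ} (hε0 : -1 ≤ ε) (hε1 : ε ≤ 1) (hR0 : 0 ≤ R) (hR1 : R ≤ 1) :
    0 ≤ 1 + ε * R ∧ 1 + ε * R ≤ 2 := by
  constructor
  · nlinarith [mul_nonneg (by linarith : (0 : ℚ) ≤ 1 + ε) hR0]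
  · nlinarith [mul_nonneg hR0 (by linarith : (0 : ℚ) ≤ 1 - ε)]

/-- `0 ≤ 1 − y ε R ≤ 2` for `0 ≤ y ≤ F`, `y ≤ Q`, `ε F ≤ 1`, `−ε ≤ s_Q`, `Q s_Q ≤ 1`, `0 ≤ R ≤ 1` (the `b`-weights). -/
theorem gen_b_bounds {y ε R F Q sQ : ℚ} (hy0 : 0 ≤ y) (hyF : y ≤ F) (hyQ : y ≤ Q) (hεF : ε * F ≤ 1)
    (hεs : -ε ≤ sQ) (hs0 : 0 ≤ sQ) (hQs : Q * sQ ≤ 1) (hF0 : 0 < F) (hQ0 : 0 ≤ Q) (hR0 : 0 ≤ R) (hR1 : R ≤ 1) :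
    0 ≤ 1 - y * ε * R ∧ 1 - y * ε * R ≤ 2 := by
  rcases lt_or_ge 0 ε with hε | hε
  · constructor
    · have : y * ε * R ≤ F * ε * 1 :=
        mul_le_mul (mul_le_mul_of_nonneg_right hyF hε.le) hR1 hR0 (by positivity)
      linarith
    · have : 0 ≤ y * ε * R := mul_nonneg (mul_nonneg hy0 hε.le) hR0
      linarith
  · constructor
    · have : 0 ≤ y * (-ε) * R := mul_nonneg (mul_nonneg hy0 (by linarith)) hR0
      linarith
    · have : y * (-ε) * R ≤ Q * sQ * 1 :=
        mul_le_mul (mul_le_mul hyQ hεs (by linarith) hQ0) hR1 hR0 (mul_nonneg hQ0 hs0)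
      linarith

/-- **THE KEY**: `G Q ε ≤ 1` for `ε = 1/F − (G−1)/(G(Q+2−G))`, `G ≥ 4`, `Q ≥ G(G−2)`, `F ≥ Q` — the type-0 demand
`b₀ ≥ (G−1)/G` (as `G Q (G(Q+2−G) − (G−1)F) ≤ F(GQ + 2 − G)` and `(G−1)(G−2) ≥ 0`). -/
theorem gen_key {G Q F : ℚ} (hG : 4 ≤ G) (hGQ : G * (G - 2) ≤ Q) (hQF : Q ≤ F) :
    G * Q * (1 / F - (G - 1) / (G * (Q + 2 - G))) ≤ 1 := by
  have hG0 : 0 < G := by linarith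
  have hQ0 : 0 < Q := by nlinarith
  have hF0 : 0 < F := by linarith
  have hQG : 0 < Q + 2 - G := by nlinarith
  have h2 : G * Q * (1 / F - (G - 1) / (G * (Q + 2 - G))) =
      (G * Q * (Q + 2 - G) - F * Q * (G - 1)) / (F * (Q + 2 - G)) := by
    field_simp
  rw [h2, div_le_one (mul_pos hF0 hQG)]
  have h4 : Q * (G * Q + 2 - G) ≤ F * (G * Q + 2 - G) :=
    mul_le_mul_of_nonneg_right hQF (by nlinarith)
  nlinarith [mul_nonneg hQ0.le (mul_nonneg (by linarith : (0 : ℚ) ≤ G - 1) (by linarith : (0 : ℚ) ≤ G - 2))]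

/-- The demand of type `t` (`1 ≤ t ≤ g − 2`) is EXACT: `(G−t) b_t + (F+1−G+t) a_t = F + 1` with `b_t = 1 − ((Q−t)/(t+1)) ε R`
and `a_t = 1 + ((G−t)(Q−t))/((t+1)(F−G+t+1)) ε R`. -/
theorem gen_dem_exact {G Q F T ε R : ℚ} (hT : 0 ≤ T) (hFG : G ≤ F) :
    (G - T) * (1 - (Q - T) / (T + 1) * ε * R) +
      (F + 1 - G + T) * (1 + (G + 1 - (T + 1)) * (Q + 1 - (T + 1)) / ((T + 1) * (F - G + (T + 1))) * ε * R) =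
      F + 1 := by
  have h1 : T + 1 ≠ 0 := by positivity
  have h2 : F - G + (T + 1) ≠ 0 := by
    have : 0 < F - G + (T + 1) := by linarith
    exact ne_of_gt this
  field_simp
  ring

/-- The capacity at `s ≥ 1` is EXACT: `s b_{s−1} + (Q+1−s) a_s = Q + 1`. -/
theorem gen_cap_exact {Q S ε R : ℚ} (hS : 0 ≤ S) :
    (S + 1) * (1 - (Q - S) / (S + 1) * ε * R) + (Q - S) * (1 + ε * R) = Q + 1 := by
  have h1 : S + 1 ≠ 0 := by positivity
  field_simp
  ring

/-- The `Q'`-capacity is EXACT: `(Q+2−G) + G(Q+2−G) s_Q = Q + 1`. -/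
theorem gen_capQ_exact {G Q : ℚ} (hG0 : G ≠ 0) (hQG : Q + 2 - G ≠ 0) :
    (Q + 2 - G) + G * (Q + 2 - G) * ((G - 1) / (G * (Q + 2 - G))) = Q + 1 := by
  field_simp
  ring

/-- The top demand is EXACT: `F (1 + (1/F − s_Q) + s_Q) = F + 1`. -/
theorem gen_top_exact {F sQ : ℚ} (hF0 : F ≠ 0) : F * (1 + (1 / F - sQ) * 1 + sQ) = F + 1 := by
  field_simp
  ring

/-- The (Cap)(iii) bound of the uniform inner payment `σ = 2/f`: `c + c (q + 2 − c) · 2/f ≤ q + 1` for `c ≤ g − 1`,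
`g ≥ 4`, `q ≥ g (g − 2)` (so `2(g−1) ≤ q + 2` and `3(g − 1) ≤ q + 1`), `f ≥ q`. -/
theorem gen_capiii {g q f c : ℕ} (hg : 4 ≤ g) (hq : g * (g - 2) ≤ q) (hf : q ≤ f) (hc : c + 1 ≤ g) :
    (c : ℚ) + ((c * (q + 2 - c) : ℕ) : ℚ) * (2 / (f : ℚ)) ≤ q + 1 := by
  have h2g : 2 * g ≤ q := by
    have h2 : 2 ≤ g - 2 := by omega
    have := Nat.mul_le_mul_left g h2
    omega
  have hG4 : (4 : ℚ) ≤ g := by exact_mod_cast hg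
  have hGQ : (g : ℚ) * ((g : ℚ) - 2) ≤ q := by
    have h : ((g * (g - 2) : ℕ) : ℚ) ≤ q := by exact_mod_cast hq
    rw [Nat.cast_mul, Nat.cast_sub (by omega)] at h
    push_cast at h
    exact h
  have hF0 : (0 : ℚ) < f := by
    have : (q : ℚ) ≤ f := by exact_mod_cast hf
    nlinarith
  have h1 : c * (q + 2 - c) ≤ (g - 1) * f := by
    have hqg : q + 3 - g ≤ f := by omega
    calc c * (q + 2 - c) ≤ (g - 1) * (q + 3 - g) := prod_le_of_le hc (by omega) (by omega)
      _ ≤ (g - 1) * f := Nat.mul_le_mul_left _ hqg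
  have eg : (((g - 1) * f : ℕ) : ℚ) = ((g : ℚ) - 1) * f := by
    rw [Nat.cast_mul, Nat.cast_sub (by omega)]
    push_cast
    ring
  have h1' : ((c * (q + 2 - c) : ℕ) : ℚ) ≤ ((g : ℚ) - 1) * f := by
    have h1c : ((c * (q + 2 - c) : ℕ) : ℚ) ≤ (((g - 1) * f : ℕ) : ℚ) := Nat.cast_le.mpr h1
    rw [eg] at h1c
    exact h1c
  have h2 : ((c * (q + 2 - c) : ℕ) : ℚ) * (2 / (f : ℚ)) ≤ ((g : ℚ) - 1) * 2 := by
    have hσ : (0 : ℚ) ≤ 2 / (f : ℚ) := by positivity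
    calc ((c * (q + 2 - c) : ℕ) : ℚ) * (2 / (f : ℚ)) ≤ ((g : ℚ) - 1) * f * (2 / (f : ℚ)) :=
          mul_le_mul_of_nonneg_right h1' hσ
      _ = ((g : ℚ) - 1) * 2 := by field_simp
  have hc' : (c : ℚ) ≤ (g : ℚ) - 1 := by
    have : ((c : ℕ) : ℚ) + 1 ≤ ((g : ℕ) : ℚ) := by exact_mod_cast hc
    linarith
  nlinarith [mul_nonneg (by linarith : (0 : ℚ) ≤ (g : ℚ) - 1) (by linarith : (0 : ℚ) ≤ (g : ℚ) - 4)]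

end ThinGirth
end PercRepro
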